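import Summits.QuantumFields.YangMills.Theorems.SwapVirialDeficitBlowUpChartDeficitBoxTwisted
import Summits.QuantumFields.YangMills.Theorems.SwapVirialDeficitBlowUpChartDeficitBox
import Literature.MathematicalPhysics.QuantumFieldTheory.TiltedExponentMorseBounds
import HarnessLib

/-!
# THE ZERO SET OF THE CHART DEFICIT IS EXACTLY THE FLAT VALLEY BOTTOM: `F̂_z(C,U) = 0 ↔ (relations_z(C) = 0 ∧ U ≡ 1)`, every sector
# (free-hands support of ⟨stmt-QuantumFields-24197⟩ `SwapVirialDeficit.SwapGluedStiffness`; brick W3, second clause «`F̂ = 0` on `{y = 0} × B`» of LEAD ym-line-sfw-p2 g97's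
# steep-window Morse–Bott plan, and its converse)

The two-sided box equivalence (✓`chartBox_of_chartDeficit[_twisted]`: relations and followers `≤ poly(L)·√F̂_z`; ✓`chartDeficit[_twisted]_le_of_box`:
`F̂_z ≤ 300L⁴(t+s)²`) pins the zero set of the σ-glued chart deficit in every sector `z` (sector character `χ_z(x) = centreElem(π_z(x))`):
* ★★ `chartDeficit_twisted_eq_zero_iff (z) (q)` — `F̂_z(C,U) = 0` iff the leaders COMMUTE (`C_μC_ν = C_νC_μ`), the seam value INTERTWINES σ UP TO THE SECTOR SIGNS
  (`c·C_{σμ} = centreElem(z μ)·C_μ·c`), and EVERY follower is at its reference (`U_i = 1`): the Morse–Bott bottom `B_z × {1}` of the fibration «base = leaders,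
  fibre = followers»; ★★ `chartDeficit_eq_zero_iff` (principal sector, `χ ≡ 1`);
* ★ `chartDeficit_twisted_one_eq_zero` ∕ `chartDeficit_one_eq_zero` — the thin toron over an exactly flat leader tuple has deficit `0`;
  ★ `followers_eq_one_of_chartDeficit_eq_zero`, `relations_of_chartDeficit_twisted_eq_zero` (the two projections of the «only if»).
For `z = 001`: the bottom is `{C₀C₁ = C₁C₀, [C_μ,C₂] = 0, cC₁ = C₀c, cC₀ = C₁c, cC₂c⁻¹ = −C₂}` — the minus valley.

HONEST LABEL: bookkeeping on landed inequalities; ⟨24197⟩ (window-uniform) ∕ ⟨24196⟩ ∕ ⟨24194⟩ ∕ ⟨24497⟩ OPEN; own crux ⟨22884⟩ OPEN (blocked-on ⟨19935⟩); no crux, rung of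
record or summit is proved; the Yang–Mills mass gap is NOT proved; no summit is proved by a line.  THEOREMS ONLY (0 `def`, 0 `sorry`), standard axioms.
Width seat ym-line-sfw-p2-w3 g65 (cell ym-idea-1, free hands), `--supports stmt-QuantumFields-24197`.  References: [cite: tHooft1979]; [cite: Luscher1983, §2]; [folklore].
-/

set_option autoImplicit false

noncomputable section

open MeasureTheory
open scoped BigOperators
open Literature.MathematicalPhysics.QuantumFieldTheory hiding SU2
open Literature.MathematicalPhysics.QuantumLattice
open Literature.MathematicalPhysics.QuantumFieldTheory.OneLinkLaplace (eq_zero_of_frobNorm_eq_zero)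

namespace Summit.QuantumFields.YangMills.Theorems.SwapVirialDeficit.BlowUpRing

open Summit.QuantumFields.YangMills.Theorems.FemtoTransferGap
open Summit.QuantumFields.YangMills.Theorems.FemtoTransferGap.TT
open Summit.QuantumFields.YangMills.Theorems.VirialFluxGap.RingDeficit
open Summit.QuantumFields.YangMills.Theorems.SwapVirialDeficit.SwapRing

variable {L : ℕ} [NeZero L]

omit [NeZero L] in
/-- Two `SU(2)` matrices at Frobenius distance `≤ 0` are equal. [folklore] -/
theorem su2_eq_of_frobNorm_sub_le_zero {A B : SU2} (h : frobNorm ((A : Matrix (Fin 2) (Fin 2) ℂ) - (B : Matrix (Fin 2) (Fin 2) ℂ)) ≤ 0) : A = B :=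
  Subtype.ext (sub_eq_zero.1 (eq_zero_of_frobNorm_eq_zero (le_antisymm h (frobNorm_nonneg _))))

/-- ★★ **THE ZERO SET OF THE SECTOR-`z` CHART DEFICIT IS THE FLAT VALLEY BOTTOM `B_z × {1}`**: for every sector `z` and chart point `q = (C, U)`,
`F̂_z(C,U) = 0 ↔ (∀ μ ν, C_μC_ν = C_νC_μ) ∧ (∀ μ, c·C_{σμ} = centreElem(z μ)·C_μ·c) ∧ (∀ i, U_i = 1)` (`c = C 3`, `σ = (0 1)`).
«Only if»: ✓`chartBox_of_chartDeficit_twisted` with `√0 = 0`; «if»: ✓`chartDeficit_twisted_le_of_box` with `t = s = 0`. [cite: tHooft1979] [cite: Luscher1983, §2] -/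
theorem chartDeficit_twisted_eq_zero_iff (z : Fin 3 → Bool) (q : (Fin 4 → SU2) × (Fol L → SU2)) :
    chartDeficit L z (fun x => centreElem (Bool.xor (z 0 && decide (x 0 ≠ 0)) (Bool.xor (z 1 && decide (x 1 ≠ 0)) (z 2 && decide (x 2 ≠ 0))))) q = 0 ↔
      (∀ μ ν : Fin 3, q.1 (Fin.castSucc μ) * q.1 (Fin.castSucc ν) = q.1 (Fin.castSucc ν) * q.1 (Fin.castSucc μ)) ∧
      (∀ μ : Fin 3, q.1 (Fin.last 3) * q.1 (Fin.castSucc (Equiv.swap (0 : Fin 3) 1 μ)) = centreElem (z μ) * q.1 (Fin.castSucc μ) * q.1 (Fin.last 3)) ∧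
      (∀ i : Fol L, q.2 i = 1) := by
  constructor
  · intro h0
    obtain ⟨hCC, hσ, hU⟩ := chartBox_of_chartDeficit_twisted (L := L) z q
    simp only [h0, Real.sqrt_zero, mul_zero] at hCC hσ hU
    refine ⟨fun μ ν => su2_eq_of_frobNorm_sub_le_zero (hCC μ ν), fun μ => su2_eq_of_frobNorm_sub_le_zero (hσ μ), fun i => ?_⟩
    exact su2_eq_of_frobNorm_sub_le_zero (B := 1) (by simpa only [OneMemClass.coe_one] using hU i)
  · rintro ⟨hCC, hσ, hU⟩
    have h := chartDeficit_twisted_le_of_box (L := L) z q (t := 0) (s := 0) le_rfl le_rfl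
      (fun μ ν => by rw [hCC μ ν, sub_self, frobNorm_zero]) (fun μ => by rw [hσ μ, sub_self, frobNorm_zero])
      (fun i => by rw [hU i, OneMemClass.coe_one, sub_self, frobNorm_zero])
    have h0 : 300 * (L : ℝ) ^ 4 * (0 + 0) ^ 2 = 0 := by ring
    exact le_antisymm (h.trans h0.le) (chartDeficit_nonneg z _ q)

/-- ★★ **THE ZERO SET OF THE PRINCIPAL CHART DEFICIT** (`χ ≡ 1`): `F̂(C,U) = 0 ↔ (∀ μ ν, C_μC_ν = C_νC_μ) ∧ (∀ μ, c·C_{σμ} = C_μ·c) ∧ (∀ i, U_i = 1)` — commuting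
leaders whose seam value intertwines the axis swap, all followers at their references. [cite: tHooft1979] [cite: Luscher1983, §2] -/
theorem chartDeficit_eq_zero_iff (q : (Fin 4 → SU2) × (Fol L → SU2)) :
    chartDeficit L (fun _ => false) (fun _ => 1) q = 0 ↔
      (∀ μ ν : Fin 3, q.1 (Fin.castSucc μ) * q.1 (Fin.castSucc ν) = q.1 (Fin.castSucc ν) * q.1 (Fin.castSucc μ)) ∧
      (∀ μ : Fin 3, q.1 (Fin.last 3) * q.1 (Fin.castSucc (Equiv.swap (0 : Fin 3) 1 μ)) = q.1 (Fin.castSucc μ) * q.1 (Fin.last 3)) ∧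
      (∀ i : Fol L, q.2 i = 1) := by
  constructor
  · intro h0
    obtain ⟨hCC, hσ, hU⟩ := chartBox_of_chartDeficit (L := L) q
    simp only [h0, Real.sqrt_zero, mul_zero] at hCC hσ hU
    refine ⟨fun μ ν => su2_eq_of_frobNorm_sub_le_zero (hCC μ ν), fun μ => su2_eq_of_frobNorm_sub_le_zero (hσ μ), fun i => ?_⟩
    exact su2_eq_of_frobNorm_sub_le_zero (B := 1) (by simpa only [OneMemClass.coe_one] using hU i)
  · rintro ⟨hCC, hσ, hU⟩
    have h := chartDeficit_le_of_box (L := L) q (t := 0) (s := 0) le_rfl le_rfl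
      (fun μ ν => by rw [hCC μ ν, sub_self, frobNorm_zero]) (fun μ => by rw [hσ μ, sub_self, frobNorm_zero])
      (fun i => by rw [hU i, OneMemClass.coe_one, sub_self, frobNorm_zero])
    have h0 : 300 * (L : ℝ) ^ 4 * (0 + 0) ^ 2 = 0 := by ring
    exact le_antisymm (h.trans h0.le) (chartDeficit_nonneg _ _ q)

/-- ★ **The thin toron over an exactly flat sector-`z` leader tuple has deficit `0`**: commuting leaders with `c·C_{σμ} = centreElem(z μ)·C_μ·c` ⟹ `F̂_z(C, 1) = 0`.
[cite: tHooft1979] [cite: Luscher1983, §2] -/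
theorem chartDeficit_twisted_one_eq_zero (z : Fin 3 → Bool) (C : Fin 4 → SU2)
    (hCC : ∀ μ ν : Fin 3, C (Fin.castSucc μ) * C (Fin.castSucc ν) = C (Fin.castSucc ν) * C (Fin.castSucc μ))
    (hσ : ∀ μ : Fin 3, C (Fin.last 3) * C (Fin.castSucc (Equiv.swap (0 : Fin 3) 1 μ)) = centreElem (z μ) * C (Fin.castSucc μ) * C (Fin.last 3)) :
    chartDeficit L z (fun x => centreElem (Bool.xor (z 0 && decide (x 0 ≠ 0)) (Bool.xor (z 1 && decide (x 1 ≠ 0)) (z 2 && decide (x 2 ≠ 0)))))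
      (C, fun _ => 1) = 0 :=
  (chartDeficit_twisted_eq_zero_iff (L := L) z (C, fun _ => 1)).2 ⟨hCC, hσ, fun _ => rfl⟩

/-- ★ **The thin toron over an exactly flat leader tuple has deficit `0`** (principal sector). [cite: Luscher1983, §2] -/
theorem chartDeficit_one_eq_zero (C : Fin 4 → SU2)
    (hCC : ∀ μ ν : Fin 3, C (Fin.castSucc μ) * C (Fin.castSucc ν) = C (Fin.castSucc ν) * C (Fin.castSucc μ))
    (hσ : ∀ μ : Fin 3, C (Fin.last 3) * C (Fin.castSucc (Equiv.swap (0 : Fin 3) 1 μ)) = C (Fin.castSucc μ) * C (Fin.last 3)) :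
    chartDeficit L (fun _ => false) (fun _ => 1) (C, fun _ => 1) = 0 :=
  (chartDeficit_eq_zero_iff (L := L) (C, fun _ => 1)).2 ⟨hCC, hσ, fun _ => rfl⟩

/-- ★ A zero of the sector-`z` deficit has ALL followers at their references (the fibre coordinate of the bottom is `y = 0`). [cite: Luscher1983, §2] -/
theorem followers_eq_one_of_chartDeficit_twisted_eq_zero (z : Fin 3 → Bool) (q : (Fin 4 → SU2) × (Fol L → SU2))
    (h0 : chartDeficit L z (fun x => centreElem (Bool.xor (z 0 && decide (x 0 ≠ 0)) (Bool.xor (z 1 && decide (x 1 ≠ 0)) (z 2 && decide (x 2 ≠ 0))))) q = 0) :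
    q.2 = fun _ => 1 :=
  funext ((chartDeficit_twisted_eq_zero_iff (L := L) z q).1 h0).2.2

/-- ★ A zero of the sector-`z` deficit has exactly flat, correctly signed leaders. [cite: tHooft1979] [cite: Luscher1983, §2] -/
theorem relations_of_chartDeficit_twisted_eq_zero (z : Fin 3 → Bool) (q : (Fin 4 → SU2) × (Fol L → SU2))
    (h0 : chartDeficit L z (fun x => centreElem (Bool.xor (z 0 && decide (x 0 ≠ 0)) (Bool.xor (z 1 && decide (x 1 ≠ 0)) (z 2 && decide (x 2 ≠ 0))))) q = 0) :
    (∀ μ ν : Fin 3, q.1 (Fin.castSucc μ) * q.1 (Fin.castSucc ν) = q.1 (Fin.castSucc ν) * q.1 (Fin.castSucc μ)) ∧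
      (∀ μ : Fin 3, q.1 (Fin.last 3) * q.1 (Fin.castSucc (Equiv.swap (0 : Fin 3) 1 μ)) = centreElem (z μ) * q.1 (Fin.castSucc μ) * q.1 (Fin.last 3)) :=
  ⟨((chartDeficit_twisted_eq_zero_iff (L := L) z q).1 h0).1, ((chartDeficit_twisted_eq_zero_iff (L := L) z q).1 h0).2.1⟩

/-- ★ **The deficit is zero EXACTLY on the thin torons of the flat bottom**: `F̂_z(C,U) = 0 ↔ (U ≡ 1 ∧ F̂_z(C,1) = 0)` — the form used by a Morse–Bott fibration
«fibre = followers». [cite: Luscher1983, §2] -/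
theorem chartDeficit_twisted_eq_zero_iff_followers_and_base (z : Fin 3 → Bool) (q : (Fin 4 → SU2) × (Fol L → SU2)) :
    chartDeficit L z (fun x => centreElem (Bool.xor (z 0 && decide (x 0 ≠ 0)) (Bool.xor (z 1 && decide (x 1 ≠ 0)) (z 2 && decide (x 2 ≠ 0))))) q = 0 ↔
      (q.2 = fun _ => 1) ∧
        chartDeficit L z (fun x => centreElem (Bool.xor (z 0 && decide (x 0 ≠ 0)) (Bool.xor (z 1 && decide (x 1 ≠ 0)) (z 2 && decide (x 2 ≠ 0)))))
          (q.1, fun _ => 1) = 0 := by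
  rw [chartDeficit_twisted_eq_zero_iff, chartDeficit_twisted_eq_zero_iff]
  constructor
  · rintro ⟨hCC, hσ, hU⟩; exact ⟨funext hU, hCC, hσ, fun _ => rfl⟩
  · rintro ⟨hU, hCC, hσ, -⟩; exact ⟨hCC, hσ, fun i => congrFun hU i⟩

end Summit.QuantumFields.YangMills.Theorems.SwapVirialDeficit.BlowUpRing

end
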